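import Literature.NumberTheory.Transcendental.KZFibredRelations
import Literature.NumberTheory.Transcendental.KZProductIdeal

/-!
# `BetaCancellation` (stmt-KontsevichZagierPeriods-13633), line `dirichlet-companion-to-pi` — stub `stub_piMulFibred`

**Disc multiples of relations are fibred relations.** Let `P n r : IntegralRep (n + 2)` be the
pinned disc family of item 0540 (domain `{z | z₀² + z₁² ≤ 1 ∧ (z₂, …, z_{n+1}) ∈ r.domain}`,
integrand `z ↦ r.integrand (z₂, …, z_{n+1})`) and `L := FreeAbelianGroup.lift (of ∘ P)` (left
multiplication by `[π]` in this typing). Then `L` maps `KZ.relations` into `KZ.fibredRelations`: by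
`AddSubgroup.closure_le` it suffices to treat one generator of each of the four kinds
[Kontsevich–Zagier 2001, §1.2, rules (1)–(3)]:

* domain additivity ↦ domain additivity in dimension `k + 2` (`piMulFib_domainAdd`; the overlap lies
  in the cylinder over the null set `σ₁ ∩ σ₂` of the trailing block, null by `KZ.volume_cylinder`
  transported along `Fin (2 + k) ≃ Fin (k + 2)`: `piMulFib_volume_setOf_tail_mem`);
* integrand additivity ↦ integrand additivity (`piMulFib_integrandAdd`);
* a change of variables `Φ` on `r.domain ⊆ ℝᵏ` ↦ the change of variables `Ψ z = (z₀, z₁, Φ (z₂, …))`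
  between representations of dimension `(k + 1) + 1`, block derivative `id × Φ'` (conjugated by
  `ℝ² × ℝᵏ ≃ ℝ^{k+2}`), `|det Ψ'| = |det Φ'|`, and `Ψ z 0 = z 0` — a FIBRED change of variables
  (`piMulFib_changeOfVariables`; pattern of `KZ.of_mul_mem_relations_of_mem_changeOfVariablesRel`,
  semialgebraicity of `Ψ` coordinatewise via `IsSemialgebraicFunOn.comp_isSemialgebraicMapOn_holds`);
* Newton–Leibniz (band `r : IntegralRep (k + 1)` over `r' : IntegralRep k`, last coordinate) ↦
  Newton–Leibniz along the last coordinate of `P (k+1) r : IntegralRep ((k+2)+1)` over the base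
  `P k r' : IntegralRep ((k+1)+1)` (disc block in front, untouched) — a FIBRED Newton–Leibniz move
  (`piMulFib_newtonLeibniz`, `KZ.of_sub_of_mem_fibredNewtonLeibnizRel`).

No definitions; sorry-free; axioms ⊆ {propext, Classical.choice, Quot.sound}.

References: M. Kontsevich, D. Zagier, *Periods* (2001), §1.2 rules (1)–(3), §4.1; J. Ayoub, *Une
version relative de la conjecture des périodes de Kontsevich–Zagier*, Ann. of Math. 181 (2015), §1.
-/

noncomputable section

-- `Summit.KontsevichZagierPeriods.KontsevichZagierPeriods.…` is the tree's mandated layout (single-conjunct summit).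
set_option linter.dupNamespace false

namespace Summit.KontsevichZagierPeriods.KontsevichZagierPeriods.BetaCancellationLine

open Set MeasureTheory
open Literature.NumberTheory.Transcendental
open Literature.NumberTheory.Transcendental.KZ
open Literature.ModelTheory.ExponentialFields (IsSemialgebraic)
open MvPolynomial (X)

variable {k : ℕ}

/-! ### §1 The trailing block `z ↦ (z₂, …, z_{k+1})` of `ℝ^{k+2}` -/

/-- Relabelling coordinates along `e : Fin n ≃ Fin m` preserves the Lebesgue measure of sets
(`volume_measurePreserving_piCongrLeft`). [folklore] -/
theorem piMulFib_volume_setOf_comp_equiv {n m : ℕ} (e : Fin n ≃ Fin m) (S : Set (Fin n → ℝ)) :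
    volume {w : Fin m → ℝ | (fun i => w (e i)) ∈ S} = volume S := by
  have hmp : MeasurePreserving (MeasurableEquiv.piCongrLeft (fun _ : Fin n => ℝ) e.symm)
      (volume : Measure (Fin m → ℝ)) (volume : Measure (Fin n → ℝ)) :=
    volume_measurePreserving_piCongrLeft (fun _ : Fin n => ℝ) e.symm
  have happ : ∀ w : Fin m → ℝ,
      MeasurableEquiv.piCongrLeft (fun _ : Fin n => ℝ) e.symm w = fun i => w (e i) := by
    intro w; ext i
    simpa using MeasurableEquiv.piCongrLeft_apply_apply e.symm (β := fun _ : Fin n => ℝ) w (e i)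
  rw [← hmp.measure_preimage_equiv S]
  congr 1; ext w
  rw [mem_preimage, happ, mem_setOf_eq]

/-- **The cylinder over a null set of the trailing block is null**: if `N ⊆ ℝᵏ` is Lebesgue-null
then so is `{z ∈ ℝ^{k+2} | (z₂, …, z_{k+1}) ∈ N}` (`KZ.volume_cylinder`: `vol (ℝ² × N) = ∞ · 0 = 0`,
transported along `Fin (2 + k) ≃ Fin (k + 2)`). [folklore] -/
theorem piMulFib_volume_setOf_tail_mem {N : Set (Fin k → ℝ)} (hN : volume N = 0) :
    volume {z : Fin (k + 2) → ℝ | (fun i : Fin k => z i.succ.succ) ∈ N} = 0 := by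
  have hC : {z : Fin (k + 2) → ℝ | (fun i : Fin k => z i.succ.succ) ∈ N} =
      {w : Fin (k + 2) → ℝ | (fun i => w (finCongr (Nat.add_comm 2 k) i)) ∈
        {z : Fin (2 + k) → ℝ | (fun i => z (Fin.castAdd k i)) ∈ (univ : Set (Fin 2 → ℝ)) ∧
          (fun j => z (Fin.natAdd 2 j)) ∈ N}} := by
    have h : ∀ j : Fin k, (finCongr (Nat.add_comm 2 k) (Fin.natAdd 2 j) : Fin (k + 2)) = j.succ.succ :=
      fun j => Fin.ext (by simp only [finCongr_apply_coe, Fin.val_natAdd, Fin.val_succ]; omega)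
    ext w
    simp only [mem_setOf_eq, mem_univ, true_and, h]
  rw [hC, piMulFib_volume_setOf_comp_equiv, volume_cylinder, hN, mul_zero]

/-- The trailing-block projection `ℝ^{k+2} → ℝᵏ` is a `ℚ`-semialgebraic (coordinate, polynomial)
map on every `ℚ`-semialgebraic set. [folklore] -/
theorem piMulFib_isSemialgebraicMapOn_tail {S : Set (Fin (k + 2) → ℝ)} (hS : IsSemialgebraic ℚ S) :
    IsSemialgebraicMapOn ℚ S (fun z : Fin (k + 2) → ℝ => fun i : Fin k => z i.succ.succ) := by
  convert isSemialgebraicMapOn_aeval hS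
    (fun i : Fin k => (X i.succ.succ : MvPolynomial (Fin (k + 2)) ℚ)) using 2 with z
  ext i
  simp

/-- A `ℚ`-semialgebraic function of the trailing block, `z ↦ G (z₂, …, z_{k+1})`, is
`ℚ`-semialgebraic on every `ℚ`-semialgebraic set whose trailing blocks lie in the domain of `G`
(composition with a semialgebraic map, `IsSemialgebraicFunOn.comp_isSemialgebraicMapOn_holds`;
Tarski–Seidenberg). [folklore] -/
theorem piMulFib_isSemialgebraicFunOn_comp_tail {S : Set (Fin (k + 2) → ℝ)} {B : Set (Fin k → ℝ)}
    {G : (Fin k → ℝ) → ℝ} (hS : IsSemialgebraic ℚ S) (hG : IsSemialgebraicFunOn ℚ B G)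
    (hSB : ∀ z ∈ S, (fun i : Fin k => z i.succ.succ) ∈ B) :
    IsSemialgebraicFunOn ℚ S (fun z => G (fun i : Fin k => z i.succ.succ)) :=
  IsSemialgebraicFunOn.comp_isSemialgebraicMapOn_holds hG (piMulFib_isSemialgebraicMapOn_tail hS) hSB

/-- On `ℝ^{(k+2)+1} = ℝ^{k+2} × ℝ`: dropping the last coordinate does not touch coordinate `0`.
[folklore] -/
theorem piMulFib_init_apply_zero (z : Fin (k + 2 + 1) → ℝ) : Fin.init z 0 = z 0 := rfl

/-- On `ℝ^{(k+2)+1}`: dropping the last coordinate does not touch coordinate `1`. [folklore] -/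
theorem piMulFib_init_apply_one (z : Fin (k + 2 + 1) → ℝ) : Fin.init z 1 = z 1 := rfl

/-- On `ℝ^{(k+2)+1}`: the trailing block commutes with dropping the last coordinate,
`init (z₂, …) = ((init z)₂, …)`. [folklore] -/
theorem piMulFib_init_tail (z : Fin (k + 2 + 1) → ℝ) :
    Fin.init (fun i : Fin (k + 1) => z i.succ.succ) = fun i : Fin k => Fin.init z i.succ.succ := rfl

/-- On `ℝ^{(k+2)+1}`: the last coordinate of the trailing block is the last coordinate. [folklore] -/
theorem piMulFib_tail_last (z : Fin (k + 2 + 1) → ℝ) :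
    z (Fin.last k).succ.succ = z (Fin.last (k + 2)) := rfl

/-- On `ℝ^{(k+2)+1}`: the trailing block of `(x, t)` is `((x₂, …), t)`. [folklore] -/
theorem piMulFib_tail_snoc (x : Fin (k + 2) → ℝ) (t : ℝ) :
    (fun i : Fin (k + 1) => (Fin.snoc x t : Fin (k + 2 + 1) → ℝ) i.succ.succ) =
      Fin.snoc (fun i : Fin k => x i.succ.succ) t := by
  ext i
  refine Fin.lastCases ?_ (fun j => ?_) i
  · simp only [Fin.succ_last, Fin.snoc_last]
  · simp only [Fin.succ_castSucc, Fin.snoc_castSucc]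

/-! ### §2 The four moves under the pinned disc family -/

section Generators

variable {P : ∀ n : ℕ, IntegralRep n → IntegralRep (n + 2)}
  (hP : ∀ (n : ℕ) (r : IntegralRep n),
    (P n r).domain = {z : Fin (n + 2) → ℝ | z 0 ^ 2 + z 1 ^ 2 ≤ 1 ∧ (fun i : Fin n => z i.succ.succ) ∈ r.domain} ∧
    (P n r).integrand = fun z => r.integrand (fun i : Fin n => z i.succ.succ))
include hP

/-- **Disc × (domain additivity) is domain additivity**: `D × (σ₁ ∪ σ₂) = (D × σ₁) ∪ (D × σ₂)`, the
overlap lies in the cylinder over the null set `σ₁ ∩ σ₂`, and the integrands `f ∘ pr`, `fᵢ ∘ pr`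
agree on `D × σᵢ`. [folklore] -/
theorem piMulFib_domainAdd {r r₁ r₂ : IntegralRep k} (hdom : r.domain = r₁.domain ∪ r₂.domain)
    (hnull : volume (r₁.domain ∩ r₂.domain) = 0) (h₁ : EqOn r.integrand r₁.integrand r₁.domain)
    (h₂ : EqOn r.integrand r₂.integrand r₂.domain) :
    of (P k r) - of (P k r₁) - of (P k r₂) ∈ domainAddRel := by
  obtain ⟨hD, hI⟩ := hP k r
  obtain ⟨hD₁, hI₁⟩ := hP k r₁
  obtain ⟨hD₂, hI₂⟩ := hP k r₂
  refine ⟨k + 2, P k r, P k r₁, P k r₂, ?_, ?_, ?_, ?_, rfl⟩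
  · rw [hD, hD₁, hD₂]
    ext z
    simp only [hdom, mem_union, mem_setOf_eq]
    tauto
  · refine measure_mono_null (fun z hz => ?_) (piMulFib_volume_setOf_tail_mem hnull)
    rw [hD₁, hD₂] at hz
    exact ⟨hz.1.2, hz.2.2⟩
  · intro z hz
    rw [hD₁] at hz; rw [hI, hI₁]
    exact h₁ hz.2
  · intro z hz
    rw [hD₂] at hz; rw [hI, hI₂]
    exact h₂ hz.2

/-- **Disc × (integrand additivity) is integrand additivity**: `(f₁ + f₂) ∘ pr = f₁ ∘ pr + f₂ ∘ pr`
on `D × σ`. [folklore] -/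
theorem piMulFib_integrandAdd {r r₁ r₂ : IntegralRep k} (h₁ : r₁.domain = r.domain)
    (h₂ : r₂.domain = r.domain) (hadd : EqOn r.integrand (r₁.integrand + r₂.integrand) r.domain) :
    of (P k r) - of (P k r₁) - of (P k r₂) ∈ integrandAddRel := by
  obtain ⟨hD, hI⟩ := hP k r
  obtain ⟨hD₁, hI₁⟩ := hP k r₁
  obtain ⟨hD₂, hI₂⟩ := hP k r₂
  refine ⟨k + 2, P k r, P k r₁, P k r₂, ?_, ?_, ?_, rfl⟩
  · rw [hD₁, hD, h₁]
  · rw [hD₂, hD, h₂]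
  · intro z hz
    rw [hD] at hz; rw [hI, hI₁, hI₂]
    exact hadd hz.2

/-- **Disc × (change of variables) is a FIBRED change of variables.** For `Φ` on `σ = r.domain ⊆ ℝᵏ`
as in rule (2), the map `Ψ z = (z₀, z₁, Φ (z₂, …))` on `D × σ ⊆ ℝ^{k+2}` is `ℚ`-semialgebraic,
injective, has derivative `id × Φ'` within `D × σ` (chain rule through `ℝ² × ℝᵏ ≃ ℝ^{k+2}`),
image `D × Φ '' σ`, `|det (id × Φ')| = |det Φ'|` (`LinearMap.det_conj`, `LinearMap.det_prodMap`),
so `f ∘ pr = ((f' ∘ pr) ∘ Ψ) · |det Ψ'|`; and `Ψ` preserves the parameter coordinate `z₀`.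
[folklore] -/
theorem piMulFib_changeOfVariables {r r' : IntegralRep k} {Φ : (Fin k → ℝ) → (Fin k → ℝ)}
    {Φ' : (Fin k → ℝ) → (Fin k → ℝ) →L[ℝ] (Fin k → ℝ)} (hΦ : IsSemialgebraicMapOn ℚ r.domain Φ)
    (hΦ' : ∀ x ∈ r.domain, HasFDerivWithinAt Φ (Φ' x) r.domain x) (hinj : InjOn Φ r.domain)
    (hdom : r'.domain = Φ '' r.domain)
    (hf : ∀ x ∈ r.domain, r.integrand x = r'.integrand (Φ x) * |(Φ' x).det|) :
    of (P k r) - of (P k r') ∈ fibredChangeOfVariablesRel := by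
  obtain ⟨hD, hI⟩ := hP k r
  obtain ⟨hD', hI'⟩ := hP k r'
  -- the linear identification `ℝ² × ℝᵏ ≃ ℝ^{k+2}` (disc coordinates first)
  let e : ((Fin 2 → ℝ) × (Fin k → ℝ)) ≃ₗ[ℝ] (Fin (k + 2) → ℝ) :=
    { toFun := fun p => Fin.cons (p.1 0) (Fin.cons (p.1 1) p.2)
      invFun := fun z => (![z 0, z 1], fun i => z i.succ.succ)
      map_add' := fun p q => by
        ext j; refine Fin.cases ?_ (fun j => Fin.cases ?_ (fun i => ?_) j) j <;> simp
      map_smul' := fun c p => by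
        ext j; refine Fin.cases ?_ (fun j => Fin.cases ?_ (fun i => ?_) j) j <;> simp
      left_inv := fun p => by
        ext j
        · fin_cases j <;> simp
        · simp
      right_inv := fun z => by
        ext j; refine Fin.cases ?_ (fun j => Fin.cases ?_ (fun i => ?_) j) j <;> simp }
  let eL : ((Fin 2 → ℝ) × (Fin k → ℝ)) ≃L[ℝ] (Fin (k + 2) → ℝ) := e.toContinuousLinearEquiv
  have heL_symm : ∀ z, eL.symm z = (![z 0, z 1], fun i => z i.succ.succ) := fun z => rfl
  -- the block map and its derivative
  let Ψ : (Fin (k + 2) → ℝ) → (Fin (k + 2) → ℝ) := eL ∘ Prod.map id Φ ∘ eL.symm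
  let Ψ' : (Fin (k + 2) → ℝ) → (Fin (k + 2) → ℝ) →L[ℝ] (Fin (k + 2) → ℝ) := fun z =>
    (eL : _ →L[ℝ] _).comp ((((ContinuousLinearMap.id ℝ (Fin 2 → ℝ)).prodMap
      (Φ' (fun i => z i.succ.succ))).comp (eL.symm : _ →L[ℝ] _)))
  have hΨ : ∀ z, Ψ z = Fin.cons (z 0) (Fin.cons (z 1) (Φ fun i => z i.succ.succ)) := fun z => rfl
  have hΨ0 : ∀ z, Ψ z 0 = z 0 := fun z => by rw [hΨ, Fin.cons_zero]
  have hΨ1 : ∀ z, Ψ z 1 = z 1 := fun z => by rw [hΨ, Fin.cons_one, Fin.cons_zero]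
  have hΨ2 : ∀ z (i : Fin k), Ψ z i.succ.succ = Φ (fun i => z i.succ.succ) i := fun z i => by
    rw [hΨ, Fin.cons_succ, Fin.cons_succ]
  have hdet : ∀ z, (Ψ' z).det = (Φ' (fun i => z i.succ.succ)).det := by
    intro z
    have hcoe : ((Ψ' z : (Fin (k + 2) → ℝ) →L[ℝ] (Fin (k + 2) → ℝ)) :
        (Fin (k + 2) → ℝ) →ₗ[ℝ] (Fin (k + 2) → ℝ)) =
      (e : ((Fin 2 → ℝ) × (Fin k → ℝ)) →ₗ[ℝ] (Fin (k + 2) → ℝ)) ∘ₗ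
        (((LinearMap.id : (Fin 2 → ℝ) →ₗ[ℝ] (Fin 2 → ℝ)).prodMap
          ((Φ' (fun i => z i.succ.succ) : (Fin k → ℝ) →L[ℝ] (Fin k → ℝ)) :
            (Fin k → ℝ) →ₗ[ℝ] (Fin k → ℝ))) ∘ₗ
        (e.symm : (Fin (k + 2) → ℝ) →ₗ[ℝ] ((Fin 2 → ℝ) × (Fin k → ℝ)))) :=
      LinearMap.ext fun v => rfl
    change LinearMap.det _ = LinearMap.det _
    rw [hcoe, LinearMap.det_conj, LinearMap.det_prodMap, LinearMap.det_id, one_mul]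
  have hS : (P k r).domain = eL.symm ⁻¹' (piDisc ×ˢ r.domain) := by
    ext z
    rw [hD, mem_preimage, heL_symm, mem_prod, mem_setOf_eq, mem_piDisc]
    simp
  have hDs : IsSemialgebraic ℚ (P k r).domain := (P k r).isSemialgebraic_domain
  have hmaps : ∀ z ∈ (P k r).domain, (fun i : Fin k => z i.succ.succ) ∈ r.domain := by
    intro z hz
    rw [hD] at hz
    exact hz.2
  refine ⟨k + 1, P k r, P k r', Ψ, Ψ', ?_, ?_, ?_, ?_, ?_, ?_, rfl⟩
  · -- semialgebraic, coordinatewise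
    refine IsSemialgebraicMapOn.of_forall hDs fun j => ?_
    refine Fin.cases ?_ (fun j => Fin.cases ?_ (fun i => ?_) j) j
    · simp only [hΨ0]
      convert isSemialgebraicFunOn_aeval hDs (X 0 : MvPolynomial (Fin (k + 2)) ℚ) using 2 with z
      simp
    · simp only [Fin.succ_zero_eq_one, hΨ1]
      convert isSemialgebraicFunOn_aeval hDs (X 1 : MvPolynomial (Fin (k + 2)) ℚ) using 2 with z
      simp
    · simp only [hΨ2]
      exact piMulFib_isSemialgebraicFunOn_comp_tail hDs
        ((isSemialgebraicMapOn_iff_forall_holds r.isSemialgebraic_domain).mp hΦ i) hmaps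
  · -- derivative within the cylinder
    intro z hz
    have hx : (fun i => z i.succ.succ) ∈ r.domain := hmaps z hz
    have hg : HasFDerivWithinAt (Prod.map id Φ)
        ((ContinuousLinearMap.id ℝ (Fin 2 → ℝ)).prodMap (Φ' (fun i => z i.succ.succ)))
        (piDisc ×ˢ r.domain) (eL.symm z) := by
      refine HasFDerivWithinAt.prodMap (eL.symm z) (hasFDerivWithinAt_id _ _) ((hΦ' _ hx).mono ?_)
      rintro _ ⟨q, hq, rfl⟩
      exact hq.2
    have h2 := (eL.comp_hasFDerivWithinAt_iff).mpr hg
    have h3 := (eL.symm.comp_right_hasFDerivWithinAt_iff (f := eL ∘ Prod.map id Φ)).mpr h2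
    rw [hS]
    exact h3
  · -- injective
    intro z₁ hz₁ z₂ hz₂ h
    have h0 : z₁ 0 = z₂ 0 := by rw [← hΨ0 z₁, ← hΨ0 z₂, h]
    have h1 : z₁ 1 = z₂ 1 := by rw [← hΨ1 z₁, ← hΨ1 z₂, h]
    have h2 : Φ (fun i => z₁ i.succ.succ) = Φ (fun i => z₂ i.succ.succ) := by
      funext i
      rw [← hΨ2 z₁, ← hΨ2 z₂, h]
    have htl := hinj (hmaps z₁ hz₁) (hmaps z₂ hz₂) h2
    funext j
    refine Fin.cases ?_ (fun j => Fin.cases ?_ (fun i => ?_) j) j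
    · exact h0
    · simpa using h1
    · exact congrFun htl i
  · -- image
    ext w
    rw [hD', hD, mem_setOf_eq, mem_image]
    constructor
    · rintro ⟨hw, hw'⟩
      rw [hdom] at hw'
      obtain ⟨x, hx, hwx⟩ := hw'
      refine ⟨Fin.cons (w 0) (Fin.cons (w 1) x), ?_, ?_⟩
      · simp only [mem_setOf_eq, Fin.cons_zero, Fin.cons_one, Fin.cons_succ]
        exact ⟨hw, hx⟩
      · rw [hΨ]
        funext j
        refine Fin.cases ?_ (fun j => Fin.cases ?_ (fun i => ?_) j) j
        · simp
        · simp
        · simp only [Fin.cons_succ]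
          exact congrFun hwx i
    · rintro ⟨z, ⟨hz, hz'⟩, rfl⟩
      refine ⟨?_, ?_⟩
      · rw [hΨ0, hΨ1]
        exact hz
      · simp only [hΨ2]
        rw [hdom]
        exact mem_image_of_mem Φ hz'
  · -- integrands
    intro z hz
    rw [hI, hI', hdet]
    simp only [hΨ2]
    exact hf _ (hmaps z hz)
  · -- the parameter coordinate is preserved
    exact fun z _ => hΨ0 z

/-- **Disc × (Newton–Leibniz) is a FIBRED Newton–Leibniz move.** If `[r] − [r']` is rule (3) along
the last coordinate over the base `τ' = r'.domain ⊆ ℝᵏ` with bounds `a ≤ b` and primitive `F`, then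
`D × band ⊆ ℝ^{(k+2)+1}` is the band over the base `D × τ' ⊆ ℝ^{(k+1)+1}` with bounds `a ∘ pr`,
`b ∘ pr` and primitive `F ∘ pr` (the disc block sits in front and is untouched), so
`[P r] − [P r']` is Newton–Leibniz over a base of dimension `≥ 1`. [folklore] -/
theorem piMulFib_newtonLeibniz {r : IntegralRep (k + 1)} {r' : IntegralRep k}
    {a b : (Fin k → ℝ) → ℝ} {F : (Fin (k + 1) → ℝ) → ℝ} (hF : IsSemialgebraicFunOn ℚ r.domain F)
    (ha : IsSemialgebraicFunOn ℚ r'.domain a) (hb : IsSemialgebraicFunOn ℚ r'.domain b)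
    (hab : ∀ x ∈ r'.domain, a x ≤ b x)
    (hdom : r.domain = {z | (Fin.init z : Fin k → ℝ) ∈ r'.domain ∧
      a (Fin.init z) ≤ z (Fin.last k) ∧ z (Fin.last k) ≤ b (Fin.init z)})
    (hcont : ∀ x ∈ r'.domain, ContinuousOn (fun t : ℝ => F (Fin.snoc x t)) (Icc (a x) (b x)))
    (hderiv : ∀ x ∈ r'.domain, ∀ t ∈ Ioo (a x) (b x),
      HasDerivAt (fun s : ℝ => F (Fin.snoc x s)) (r.integrand (Fin.snoc x t)) t)
    (hr' : ∀ x ∈ r'.domain, r'.integrand x = F (Fin.snoc x (b x)) - F (Fin.snoc x (a x))) :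
    of (P (k + 1) r) - of (P k r') ∈ fibredNewtonLeibnizRel := by
  obtain ⟨hD, hI⟩ := hP (k + 1) r
  obtain ⟨hD', hI'⟩ := hP k r'
  -- the band, retyped over `ℝ^{(k+2)+1}`
  have hD3 : ∀ z : Fin (k + 2 + 1) → ℝ, z ∈ (P (k + 1) r).domain ↔
      z 0 ^ 2 + z 1 ^ 2 ≤ 1 ∧ (fun i : Fin (k + 1) => z i.succ.succ) ∈ r.domain := fun z => by
    rw [hD]
    rfl
  have hI3 : ∀ z : Fin (k + 2 + 1) → ℝ,
      (P (k + 1) r).integrand z = r.integrand (fun i : Fin (k + 1) => z i.succ.succ) := fun z => by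
    rw [hI]
  have hmaps' : ∀ w ∈ (P k r').domain, (fun i : Fin k => w i.succ.succ) ∈ r'.domain := by
    intro w hw
    rw [hD'] at hw
    exact hw.2
  refine of_sub_of_mem_fibredNewtonLeibnizRel ⟨k + 2, P (k + 1) r, P k r',
    fun w => a (fun i => w i.succ.succ), fun w => b (fun i => w i.succ.succ),
    fun z => F (fun i => z i.succ.succ), ?_, ?_, ?_, ?_, ?_, ?_, ?_, ?_, rfl⟩
  · exact piMulFib_isSemialgebraicFunOn_comp_tail (P (k + 1) r).isSemialgebraic_domain hF
      (fun z hz => ((hD3 z).mp hz).2)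
  · exact piMulFib_isSemialgebraicFunOn_comp_tail (P k r').isSemialgebraic_domain ha hmaps'
  · exact piMulFib_isSemialgebraicFunOn_comp_tail (P k r').isSemialgebraic_domain hb hmaps'
  · exact fun w hw => hab _ (hmaps' w hw)
  · ext z
    rw [hD3]
    simp only [mem_setOf_eq, hD', hdom, piMulFib_init_apply_zero, piMulFib_init_apply_one,
      piMulFib_init_tail, piMulFib_tail_last]
    tauto
  · intro w hw
    simp only [piMulFib_tail_snoc]
    exact hcont _ (hmaps' w hw)
  · intro w hw t ht
    rw [hI3]
    simp only [piMulFib_tail_snoc]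
    exact hderiv _ (hmaps' w hw) t ht
  · intro w hw
    rw [hI']
    simp only [piMulFib_tail_snoc]
    exact hr' _ (hmaps' w hw)

end Generators

/-! ### §3 The stub -/

/-- **STUB `stub_piMulFibred` (disc multiples of relations are fibred relations)**: for every pinned
disc family `P`, `FreeAbelianGroup.lift (of ∘ P)` maps `KZ.relations` into `KZ.fibredRelations`
(`AddSubgroup.closure_le`; generatorwise `piMulFib_domainAdd`, `piMulFib_integrandAdd`,
`piMulFib_changeOfVariables`, `piMulFib_newtonLeibniz`). [folklore] -/
theorem stub_piMulFibred :
    ∀ (P : ∀ n : ℕ, IntegralRep n → IntegralRep (n + 2)),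
      (∀ (n : ℕ) (r : IntegralRep n), (P n r).domain = {z : Fin (n + 2) → ℝ | z 0 ^ 2 + z 1 ^ 2 ≤ 1 ∧ (fun i : Fin n => z i.succ.succ) ∈ r.domain} ∧ (P n r).integrand = fun z => r.integrand (fun i : Fin n => z i.succ.succ)) →
      ∀ c : FormalRep, c ∈ relations →
        FreeAbelianGroup.lift (fun s : (Σ n, IntegralRep n) => of (P s.1 s.2)) c ∈ fibredRelations := by
  intro P hP c hc
  have hL : ∀ {m : ℕ} (s : IntegralRep m),
      FreeAbelianGroup.lift (fun s : (Σ n, IntegralRep n) => of (P s.1 s.2)) (of s) = of (P m s) :=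
    fun s => FreeAbelianGroup.lift_apply_of _ _
  refine (AddSubgroup.closure_le (fibredRelations.comap
    (FreeAbelianGroup.lift (fun s : (Σ n, IntegralRep n) => of (P s.1 s.2))))).mpr ?_ hc
  rintro g (((hg | hg) | hg) | hg)
  · obtain ⟨k, r, r₁, r₂, hdom, hnull, h₁, h₂, rfl⟩ := hg
    rw [AddSubgroup.coe_comap, mem_preimage, map_sub, map_sub, hL, hL, hL]
    exact mem_fibredRelations_of_mem_domainAddRel (piMulFib_domainAdd hP hdom hnull h₁ h₂)
  · obtain ⟨k, r, r₁, r₂, h₁, h₂, hadd, rfl⟩ := hg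
    rw [AddSubgroup.coe_comap, mem_preimage, map_sub, map_sub, hL, hL, hL]
    exact mem_fibredRelations_of_mem_integrandAddRel (piMulFib_integrandAdd hP h₁ h₂ hadd)
  · obtain ⟨k, r, r', Φ, Φ', hΦ, hΦ', hinj, hdom, hf, rfl⟩ := hg
    rw [AddSubgroup.coe_comap, mem_preimage, map_sub, hL, hL]
    exact mem_fibredRelations_of_mem_fibredChangeOfVariablesRel
      (piMulFib_changeOfVariables hP hΦ hΦ' hinj hdom hf)
  · obtain ⟨k, r, r', α, β, F, hF, hα, hβ, hle, hband, hcont, hderiv, hr', rfl⟩ := hg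
    rw [AddSubgroup.coe_comap, mem_preimage, map_sub, hL, hL]
    exact mem_fibredRelations_of_mem_fibredNewtonLeibnizRel
      (piMulFib_newtonLeibniz hP hF hα hβ hle hband hcont hderiv hr')

end Summit.KontsevichZagierPeriods.KontsevichZagierPeriods.BetaCancellationLine
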